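import Literature.MathematicalPhysics.StatisticalMechanics.LennardJonesClusters

/-!
# Negative knowledge for crux `SpectralChargeLedger.OneMultiplierPricing` (stmt-AtomisticToContinuum-17253), II:
# scaling of the Lennard-Jones energy and the virial identity of a ground state

Part II (`--supports stmt-AtomisticToContinuum-17253`; used by
`Theorems/SpectralChargeLedgerOneMultiplierPricingRefutation.lean`). All `[folklore]`.
With the repulsive / attractive lattice sums `A = ∑_{i<j} r⁻¹²/12`, `B = ∑_{i<j} r⁻⁶/6` of a finite
configuration (written out, no definitions):

* `interactionEnergy_smul` — `𝓔(c·x) = c⁻¹² A − c⁻⁶ B`; `interactionEnergy_eq_rep_sub_att` —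
  `𝓔(x) = A − B`;
* **`att_eq_two_mul_rep`** — virial identity `B = 2A` for a Lennard-Jones ground state
  (stationarity of the minimiser under dilations `c·x`, `c = (1+ε)⁻¹`, `ε → 0±`);
* **`interactionEnergy_dilate_le`** — hence `𝓔((1+s)·x) − 𝓔(x) ≤ 36 s² (−𝓔(x))` for `s ≥ 0`
  (exactly `A(1 − (1+s)⁻⁶)²` with `A = −𝓔(x)`).
-/

noncomputable section

open scoped BigOperators
open Literature.MathematicalPhysics.StatisticalMechanics

namespace Summit.AtomisticToContinuum.Crystallization.Theorems.OneMultiplierPricing.Negative.Virial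

/-- `A ≥ 0`. [folklore] -/
theorem rep_nonneg {N : ℕ} (x : Fin N → EuclideanSpace ℝ (Fin 3)) :
    0 ≤ ∑ i, ∑ j ∈ Finset.Ioi i, (1 / 12 : ℝ) * ((dist (x i) (x j))⁻¹) ^ 12 :=
  Finset.sum_nonneg fun _ _ => Finset.sum_nonneg fun _ _ =>
    mul_nonneg (by norm_num) (pow_nonneg (inv_nonneg.2 dist_nonneg) _)

/-- `B ≥ 0`. [folklore] -/
theorem att_nonneg {N : ℕ} (x : Fin N → EuclideanSpace ℝ (Fin 3)) :
    0 ≤ ∑ i, ∑ j ∈ Finset.Ioi i, (1 / 6 : ℝ) * ((dist (x i) (x j))⁻¹) ^ 6 :=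
  Finset.sum_nonneg fun _ _ => Finset.sum_nonneg fun _ _ =>
    mul_nonneg (by norm_num) (pow_nonneg (inv_nonneg.2 dist_nonneg) _)

/-- **Scaling**: `𝓔(c x) = c⁻¹² A − c⁻⁶ B`. [folklore] -/
theorem interactionEnergy_smul {N : ℕ} (x : Fin N → EuclideanSpace ℝ (Fin 3)) {c : ℝ} (hc : 0 < c) :
    interactionEnergy lennardJones (fun i => c • x i) =
      (c⁻¹) ^ 12 * (∑ i, ∑ j ∈ Finset.Ioi i, (1 / 12 : ℝ) * ((dist (x i) (x j))⁻¹) ^ 12)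
      - (c⁻¹) ^ 6 * (∑ i, ∑ j ∈ Finset.Ioi i, (1 / 6 : ℝ) * ((dist (x i) (x j))⁻¹) ^ 6) := by
  unfold interactionEnergy lennardJones
  rw [Finset.mul_sum, Finset.mul_sum, ← Finset.sum_sub_distrib]
  refine Finset.sum_congr rfl fun i _ => ?_
  rw [Finset.mul_sum, Finset.mul_sum, ← Finset.sum_sub_distrib]
  refine Finset.sum_congr rfl fun j _ => ?_
  rw [dist_smul₀, Real.norm_eq_abs, abs_of_pos hc, mul_inv, mul_pow, mul_pow]
  ring

/-- `𝓔(x) = A − B`. [folklore] -/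
theorem interactionEnergy_eq_rep_sub_att {N : ℕ} (x : Fin N → EuclideanSpace ℝ (Fin 3)) :
    interactionEnergy lennardJones x =
      (∑ i, ∑ j ∈ Finset.Ioi i, (1 / 12 : ℝ) * ((dist (x i) (x j))⁻¹) ^ 12)
      - (∑ i, ∑ j ∈ Finset.Ioi i, (1 / 6 : ℝ) * ((dist (x i) (x j))⁻¹) ^ 6) := by
  have h := interactionEnergy_smul x one_pos
  simpa using h

/-- **Virial identity**: a Lennard-Jones ground state is stationary under dilations, whence
`B = 2A` (and `𝓔 = −A`). [folklore] -/
theorem att_eq_two_mul_rep {N : ℕ} {x : Fin N → EuclideanSpace ℝ (Fin 3)}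
    (hx : IsGroundState lennardJones x) :
    (∑ i, ∑ j ∈ Finset.Ioi i, (1 / 6 : ℝ) * ((dist (x i) (x j))⁻¹) ^ 6) =
      2 * (∑ i, ∑ j ∈ Finset.Ioi i, (1 / 12 : ℝ) * ((dist (x i) (x j))⁻¹) ^ 12) := by
  have hA : 0 ≤ ∑ i, ∑ j ∈ Finset.Ioi i, (1 / 12 : ℝ) * ((dist (x i) (x j))⁻¹) ^ 12 := rep_nonneg x
  have hB : 0 ≤ ∑ i, ∑ j ∈ Finset.Ioi i, (1 / 6 : ℝ) * ((dist (x i) (x j))⁻¹) ^ 6 := att_nonneg x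
  have hmin : ∀ c : ℝ, 0 < c →
      (∑ i, ∑ j ∈ Finset.Ioi i, (1 / 12 : ℝ) * ((dist (x i) (x j))⁻¹) ^ 12)
        - (∑ i, ∑ j ∈ Finset.Ioi i, (1 / 6 : ℝ) * ((dist (x i) (x j))⁻¹) ^ 6) ≤
      (c⁻¹) ^ 12 * (∑ i, ∑ j ∈ Finset.Ioi i, (1 / 12 : ℝ) * ((dist (x i) (x j))⁻¹) ^ 12)
        - (c⁻¹) ^ 6 * (∑ i, ∑ j ∈ Finset.Ioi i, (1 / 6 : ℝ) * ((dist (x i) (x j))⁻¹) ^ 6) := by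
    intro c hc
    have hinj : Function.Injective (fun i => c • x i) := fun i j h =>
      hx.1 (smul_right_injective (EuclideanSpace ℝ (Fin 3)) hc.ne' h)
    have h1 := groundStateEnergy_lennardJones_le hinj
    rw [interactionEnergy_smul x hc] at h1
    rw [← interactionEnergy_eq_rep_sub_att, hx.2]
    exact h1
  set A := ∑ i, ∑ j ∈ Finset.Ioi i, (1 / 12 : ℝ) * ((dist (x i) (x j))⁻¹) ^ 12 with hAdef
  set B := ∑ i, ∑ j ∈ Finset.Ioi i, (1 / 6 : ℝ) * ((dist (x i) (x j))⁻¹) ^ 6 with hBdef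
  -- with `c = (1+ε)⁻¹`, `v = (1+ε)⁶`: `0 ≤ (v - 1)(A(v + 1) - B)` for every `ε > -1`
  have hv : ∀ ε : ℝ, -1 < ε → 0 ≤ ((1 + ε) ^ 6 - 1) * (A * ((1 + ε) ^ 6 + 1) - B) := by
    intro ε hε
    have hc : 0 < (1 + ε)⁻¹ := inv_pos.2 (by linarith)
    have h1 := hmin _ hc
    rw [inv_inv] at h1
    have hid : ((1 + ε) ^ 6 - 1) * (A * ((1 + ε) ^ 6 + 1) - B) =
        (1 + ε) ^ 12 * A - (1 + ε) ^ 6 * B - (A - B) := by ring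
    rw [hid]; linarith
  apply le_antisymm
  · -- `B ≤ 2A`: otherwise a small dilation `ε > 0` lowers the energy
    by_contra hcon
    have hη : 0 < B - 2 * A := by linarith [not_le.mp hcon]
    set η := B - 2 * A with hη'
    set ε := min (1 / 2) (η / (64 * (A + 1))) with hεdef
    have hε0 : 0 < ε := by
      rw [hεdef]; refine lt_min (by norm_num) ?_
      exact div_pos hη (by positivity)
    have hε1 : ε ≤ 1 / 2 := min_le_left _ _
    have hε2 : ε ≤ η / (64 * (A + 1)) := min_le_right _ _
    have hε3 : 64 * (A + 1) * ε ≤ η := by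
      have := (le_div_iff₀ (by positivity : (0 : ℝ) < 64 * (A + 1))).1 hε2
      linarith
    have hvgt : 1 < (1 + ε) ^ 6 := one_lt_pow₀ (by linarith) (by norm_num)
    have hvle : (1 + ε) ^ 6 ≤ 1 + 63 * ε := by
      have e2 : ε ^ 2 ≤ ε := by nlinarith
      have e3 : ε ^ 3 ≤ ε := by nlinarith
      have e4 : ε ^ 4 ≤ ε := by nlinarith
      have e5 : ε ^ 5 ≤ ε := by nlinarith
      have e6 : ε ^ 6 ≤ ε := by nlinarith
      nlinarith
    have hneg : A * ((1 + ε) ^ 6 + 1) - B < 0 := by nlinarith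
    have := hv ε (by linarith)
    nlinarith
  · -- `2A ≤ B`: otherwise a small contraction `ε < 0` lowers the energy
    by_contra hcon
    have hη : 0 < 2 * A - B := by linarith [not_le.mp hcon]
    have hApos : 0 < A := by linarith
    set η := 2 * A - B with hη'
    set ε := - min (1 / 2) (η / (12 * A)) with hεdef
    have hm0 : 0 < min (1 / 2) (η / (12 * A)) := lt_min (by norm_num) (div_pos hη (by positivity))
    have hε0 : ε < 0 := by rw [hεdef]; linarith
    have hε1 : -(1 / 2) ≤ ε := by rw [hεdef]; linarith [min_le_left (1 / 2 : ℝ) (η / (12 * A))]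
    have hε2 : -(η / (12 * A)) ≤ ε := by
      rw [hεdef]; linarith [min_le_right (1 / 2 : ℝ) (η / (12 * A))]
    have hε3 : -η ≤ 12 * A * ε := by
      have : η / (12 * A) * (12 * A) = η := div_mul_cancel₀ η (by positivity)
      nlinarith
    have hvlt : (1 + ε) ^ 6 < 1 := pow_lt_one₀ (by linarith) (by linarith) (by norm_num)
    have hvge : 1 + 6 * ε ≤ (1 + ε) ^ 6 := by
      have := one_add_mul_le_pow (show (-2 : ℝ) ≤ ε by linarith) 6
      simpa using this
    have hpos : 0 < A * ((1 + ε) ^ 6 + 1) - B := by nlinarith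
    have := hv ε (by linarith)
    nlinarith

/-- **Energy of a dilated ground state**: `𝓔((1+s)x) − 𝓔(x) ≤ 36 s² · (−𝓔(x))` for `s ≥ 0`
(exactly `A (1 − (1+s)⁻⁶)²` with `A = −𝓔(x)`, by the virial identity). [folklore] -/
theorem interactionEnergy_dilate_le {N : ℕ} {x : Fin N → EuclideanSpace ℝ (Fin 3)}
    (hx : IsGroundState lennardJones x) {s : ℝ} (hs : 0 ≤ s) :
    interactionEnergy lennardJones (fun i => (1 + s) • x i) - interactionEnergy lennardJones x
      ≤ 36 * s ^ 2 * (- interactionEnergy lennardJones x) := by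
  have hB := att_eq_two_mul_rep hx
  have hs1 : 0 < 1 + s := by linarith
  rw [interactionEnergy_smul x hs1, interactionEnergy_eq_rep_sub_att, hB]
  have hA : 0 ≤ ∑ i, ∑ j ∈ Finset.Ioi i, (1 / 12 : ℝ) * ((dist (x i) (x j))⁻¹) ^ 12 := rep_nonneg x
  set A := ∑ i, ∑ j ∈ Finset.Ioi i, (1 / 12 : ℝ) * ((dist (x i) (x j))⁻¹) ^ 12
  set u := ((1 + s)⁻¹) ^ 6 with hu
  have hu12 : ((1 + s)⁻¹) ^ 12 = u ^ 2 := by rw [hu]; ring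
  rw [hu12]
  have hinv1 : (1 + s)⁻¹ ≤ 1 := inv_le_one_of_one_le₀ (by linarith)
  have hinv0 : 0 ≤ (1 + s)⁻¹ := inv_nonneg.2 hs1.le
  have hu1 : u ≤ 1 := pow_le_one₀ hinv0 hinv1
  have hu0 : 1 - 6 * s ≤ u := by
    have hrepr : (1 + s)⁻¹ = 1 + (-(s / (1 + s))) := by field_simp; ring
    have hge : (-2 : ℝ) ≤ -(s / (1 + s)) := by
      have : s / (1 + s) ≤ 1 := (div_le_one hs1).2 (by linarith)
      linarith
    have hb := one_add_mul_le_pow hge 6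
    rw [← hrepr] at hb
    have hfrac : s / (1 + s) ≤ s := (div_le_iff₀ hs1).2 (by nlinarith)
    have : (1 : ℝ) + (6 : ℕ) * (-(s / (1 + s))) ≥ 1 - 6 * s := by push_cast; linarith
    linarith
  have hsq : (u - 1) ^ 2 ≤ 36 * s ^ 2 := by nlinarith
  nlinarith [mul_le_mul_of_nonneg_left hsq hA]

end Summit.AtomisticToContinuum.Crystallization.Theorems.OneMultiplierPricing.Negative.Virial

end
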